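import Summits.QuantumFields.QCD.Theses.EulerDescent
import Summits.QuantumFields.QCD.Theses.AnomalyRigidity
import Summits.QuantumFields.QCD.Theorems.HeatSlicedQuarksRobustYangMillsHandoverStubAnomalyGermVanishes
import Summits.QuantumFields.QCD.Theorems.HeatSlicedQuarksRobustYangMillsHandoverStubFarMomentsBoundGerm
import Literature.MathematicalPhysics.QuantumFieldTheory.QCDGoldstoneBound

/-!
# Line `anomaly-corner` for crux `ChiralCornerSoftness` (item stmt-QuantumFields-16902) — `Lines/anomaly_corner.lean`

Route `route-QuantumFields-EulerDescent` (sub-problem QCD), crux decl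
`Summit.QuantumFields.QCD.Theses.EulerDescent.ChiralCornerSoftness` (rank 4): for `N_f ∈ {2,3}`, every regularisation
PINNED AT THE INTRINSIC WILSON CORNER (corner `IsLUB` eventually, pin `(m_crit − mc)·Z_m/a → 0`, `HasMassScaling`,
two-loop `HasAsymptoticScaling`, `m_crit > −1` eventually) is chiral at zero (`reg.IsChiralAtZero`).

Registered by the crux-strategist seat `planner-cstrat-stmt-QuantumFields-16902-b1-0` (2026-08-17) as the ALTERNATIVE to
`Lines/birth.lean` (S1 "the pinned chiral trajectory is gapless" + S2 "softness persists to `0⁺`").  TECHNIQUE WITH TEETH: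
't Hooft anomaly matching in its Euclidean Coleman–Grossman GERM form, which on this hub is a kernel-checked chain —
`AnomalyRigidity.FarMomentsBoundGerm` (stmt-17719, PROVED: `LeeYangMassHandover.stub_farMomentsBoundGerm`) and
`AnomalyRigidity.AnomalyGermVanishes` (stmt-16262, PROVED: `LeeYangMassHandover.stub_anomalyGermVanishes`) — fed by the
shared open crux `AnomalyRigidity.UniformGapFarMoments` (stmt-17718, rank 3 there; reflection positivity / transfer-matrix
technology: a uniform lattice gap ⇒ `m`-uniform far-region weighted moments of `u³⟨V V P⟩`).  The line argues BY
CONTRADICTION at POSITIVE masses only — no `m = 0` theory, no transport stub, no dichotomy broken/unbroken (a gap kills the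
anomaly in BOTH phases: Goldstone poles and massless baryons are both excluded by the gap):

  ¬`IsChiralAtZero` ⇒ one rate `ε` at ALL positive tuples (`push_neg`) ⇒ [`stub_cornerWardData`] along some subsequence
  `φ` the reindexed regularisation `reg.restrict φ` carries CENTRED ANOMALOUS WARD DATA `(V, A, P, u_V, u_A, u_P, Γ_m, Γ^P_m,
  c ≠ 0, κ > 0)` — verbatim clause (b) of `AnomalyRigidity.AnomalousWardTriple` (stmt-17716) with the PCAC coefficient
  `κ·m`, `m` the renormalised mass MEASURED FROM THE CORNER (this is where corner + pin are consumed) ⇒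
  [`stub_uniformGapFarMoments` = 17718 BY NAME, applied to `reg.restrict φ`, whose uniform gap, physical branch and
  asymptotic scaling are inherited from `reg` — proved here] far moments bounded ⇒ [17719, proved] the mixed germ of
  `Γ^P_m` is bounded by one `K` for all `m ∈ (0,1]` ⇒ [16262, proved] `c = 0` — contradiction with `c ≠ 0`.

* `stub_cornerWardData` (W — THE CORNER IS PCAC-CHIRAL, WITH THE ANOMALY INFLOW; hardest, open): for a corner-pinned
  regularisation that is uniformly lattice-gapped at one rate `ε` at every positive tuple, along some strictly increasing
  `φ` there are gauge-invariant local observables `V_μ, A_λ, P` (quark box 1), mass-independent weights, limits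
  `Γ_m, Γ^P_m` (`m ∈ (0,1]`), `c ≠ 0`, `κ > 0` with: convergence of the torus transforms of `u³⟨V V A⟩`, `u³⟨V V P⟩`
  uniformly over tori `S ≥ L`; signed-permutation pseudo-covariance; bi-transversality and differentiability at zero
  momentum; the anomalous Ward germ `(p+q)·Γ_m − κ m Γ^P_m − c·det[e_μ,e_ν,p,q] = o(|k|²)`; `m`-uniform local weighted
  moments; `m`-uniform truncated reflected pair bounds for `{1, V_μ, P}`; centring of `V_μ` and `P`.  Content (three
  foreseen children, see the card): (W-UV) the exact lattice axial Ward identity of Wilson quarks renormalises, under a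
  uniform gap and two-loop asymptotic scaling, to the continuum anomalous identity with the UNIVERSAL coefficient `c ≠ 0`
  (Karsten–Smit / Reisz power counting; Bochicchio et al. for the subtracted PCAC insertion) — subsequentially, by
  compactness from the `k`-uniform bounds plus equicontinuity in `m` (Feynman–Hellmann under the gap); (W-corner) the
  PCAC mass vanishes AT THE INTRINSIC CORNER in physical units, so that with the `o(a/Z_m)` pin the coefficient along
  `reg.scheme (m·1) 0 0` is `κ·m` (Aoki scenario: the corner is the second-order edge, `m_π = 0 = m_PCAC`; first-order
  scenario: `|m_PCAC| ≲ aΛ²` at the corner, Sharpe–Singleton); (W-bounds) tree-level power counting of `⟨VVP⟩`,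
  `⟨ΘYΘX·XY⟩` non-perturbatively along AF sequences (`σ < 4`).
* `stub_uniformGapFarMoments` := `Summit.QuantumFields.QCD.Theses.AnomalyRigidity.UniformGapFarMoments` (17718, shared BY
  NAME — staffed once; difficulty L there).

`ChiralCornerSoftness_of : Stmt.stub_cornerWardData → Stmt.stub_uniformGapFarMoments → ChiralCornerSoftness` is
kernel-checked (no `sorry`): the threading is that of `AnomalyRigidity.closes`, transplanted from its `∃ reg` to the
crux's `∀` pinned `reg` through `QCDRegularisation.restrict` (`hasLatticeMassGap_restrict`, branch and asymptotic scaling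
of the reindexed regularisation proved below).  Both stubs are load-bearing (W alone yields data, not a contradiction; 17718
alone has no data to act on).

Dead knowledge honoured: `Cruxes/RobustYangMillsHandover/Lines/Sketch-lee-yang-mass-handover-dead.md` (D2: clause (b) of
17716 "AT a GIVEN regularisation has no supplier") — W is that clause at a given reg, but (i) CONDITIONAL on the uniform
gap (it lives inside the contradiction, so compactness replaces existence of the continuum limit), (ii) SUBSEQUENTIAL
(`reg.restrict φ`), (iii) for a CORNER-PINNED reg (the PCAC coefficient is fixed by hypothesis, not located) — three
weakenings unavailable to that line, whose crux needed the data unconditionally for the body.  `ledger negatives`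
(5 entries) — none is instantiated.  Landed pin-shape lemmas (`ChiralGluonicCompletion.Negative.*`,
`ChiralMobilityGap.Negative.*`) are consistent: the line never shifts `m_crit` and never claims a gapless or sign-singular
tuple.  No `Disproof.lean` exists for 16902 (no `_false_without_` obligations).
-/

namespace Summit.QuantumFields.QCD.Cruxes.ChiralCornerSoftness.AnomalyCorner

open Filter Topology
open Literature.MathematicalPhysics.QuantumFieldTheory Literature.Probability.LatticeModels
open Summit.QuantumFields.QCD.Theses.EulerDescent (ChiralCornerSoftness)
open Summit.QuantumFields.QCD.Theses.AnomalyRigidity (UniformGapFarMoments FarMomentsBoundGerm AnomalyGermVanishes)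
open Summit.QuantumFields.QCD.Cruxes.RobustYangMillsHandover.LeeYangMassHandover
  (stub_farMomentsBoundGerm stub_anomalyGermVanishes)

/-! ## §1 The two stub STATEMENTS as named propositions (hypotheses of `ChiralCornerSoftness_of`, BY NAME) -/

namespace Stmt

/-- **Statement of stub W — centred anomalous Ward data along a subsequence, for a corner-pinned regularisation that is
uniformly lattice-gapped at every positive tuple** (clause (b) of `AnomalyRigidity.AnomalousWardTriple`, verbatim, for
`reg.restrict φ`, PCAC coefficient `κ·m`). [folklore] -/
def stub_cornerWardData : Prop :=
  ∀ Nf : ℕ, Nf = 2 ∨ Nf = 3 → ∀ (reg : QCDRegularisation Nf) (mc : ℕ → ℝ),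
      (∀ᶠ k in atTop, IsLUB {μ : ℝ | ¬ (∀ (R R' : ℕ) (A : QCDLatticeObservable Nf R)
          (B : QCDLatticeObservable Nf R'), ∃ (C δ : ℝ) (S₀ : ℕ), 0 < δ ∧ ∀ S : ℕ, S₀ ≤ S → ∀ n : ℕ, n ≤ S →
            ‖qcdLatticeConnectedCorr (reg.β k) (2 * S + 1) (fun _ : Fin Nf => μ) A B n‖ ≤
              C * Real.exp (-(δ * n)))} (mc k)) →
      Tendsto (fun k => (reg.mcrit k - mc k) * reg.Zm k / reg.a k) atTop (nhds 0) →
      reg.HasMassScaling → (reg.scheme 0 0 0).HasAsymptoticScaling →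
      (∀ᶠ k in atTop, (-1 : ℝ) < reg.mcrit k) →
      ∀ ε : ℝ, 0 < ε → (∀ m : Fin Nf → ℝ, (∀ f, 0 < m f) → (reg.scheme m 0 0).HasLatticeMassGap ε) →
      ∃ (φ : ℕ → ℕ) (hφ : StrictMono φ), ∃ (V A : Fin 4 → QCDLatticeObservable Nf 1) (P : QCDLatticeObservable Nf 1) (uV uA uP : ℕ → ℝ) (Γ : ℝ → (Fin 4 → ℝ) → (Fin 4 → ℝ) → Fin 4 → Fin 4 → Fin 4 → ℂ) (ΓP : ℝ → (Fin 4 → ℝ) → (Fin 4 → ℝ) → Fin 4 → Fin 4 → ℂ) (c : ℂ) (κ : ℝ), let reg' : QCDRegularisation Nf := reg.restrict φ hφ.tendsto_atTop; let ph := fun (k : ℕ) (x : Fin 4 → ℤ) (i : Fin 4) => reg'.a k * (x i : ℝ); let E := fun (k S : ℕ) (m : ℝ) X => qcdTorusExpect (reg'.β k) (2 * S + 1) (fun fl => (reg'.scheme (fun _ => m) 0 0).mq fl k) X; let C3 := fun (k S : ℕ) (m : ℝ) (X Y Z : QCDLatticeObservable Nf 1) x y => E k S m (fun U => X.onTorus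 (2 * S + 1) x U * Y.onTorus (2 * S + 1) y U * Z.onTorus (2 * S + 1) 0 U); let F3 := fun (k S : ℕ) (m : ℝ) X Y Z (a b d : ℕ → ℝ) (p q : Fin 4 → ℝ) => ((reg'.a k ^ 8 : ℝ) : ℂ) * ∑ x ∈ box 4 S, ∑ y ∈ box 4 S, Complex.exp (Complex.I * ((∑ i : Fin 4, (p i * ph k x i + q i * ph k y i) : ℝ) : ℂ)) * ((a k * b k * d k : ℝ) : ℂ) * C3 k S m X Y Z x y; let O := fun o : Option (Fin 4 ⊕ Unit) => Option.elim o (QCDLatticeObservable.one Nf 1) (Sum.elim V fun _ => P); let w := fun o : Option (Fin 4 ⊕ Unit) => Option.elim o (fun _ => (1 : ℝ)) (Sum.elim (fun _ => uV) fun _ => uP); let R2 := fun (S : ℕ) (X Y : QCDLatticeObservable Nf 1) x y U => Y.osAdjoint.onTorus (2 * S + 1) (siteReflect y) U * X.osAdjoint.onTorus (2 * S + 1) (siteReflect x) U; let P2 := fun (S : ℕ) (X Y : QCDLatticeObservable Nf 1) x y U => X.onTorus (2 * S + 1) x U * Y.onTorus (2 * S + 1) y U; let V8 := (Fin 4 →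 ℝ) × (Fin 4 → ℝ); let q2 := fun k : V8 => ‖k‖ ^ 2; let Ev := fun (Q : ℕ → ℕ → Prop) => ∀ᶠ k in Filter.atTop, ∀ S, reg'.L k ≤ S → Q k S; c ≠ 0 ∧ 0 < κ ∧ (∀ m : ℝ, 0 < m → m ≤ 1 → ((∀ p q μ ν la, ∀ δ : ℝ, 0 < δ → Ev fun k S => ‖F3 k S m (V μ) (V ν) (A la) uV uV uA p q - Γ m p q μ ν la‖ ≤ δ) ∧ (∀ p q μ ν, ∀ δ : ℝ, 0 < δ → Ev fun k S => ‖F3 k S m (V μ) (V ν) P uV uV uP p q - ΓP m p q μ ν‖ ≤ δ) ∧ (∀ R : Matrix (Fin 4) (Fin 4) ℝ, (∀ i j, R i j = 0 ∨ R i j = 1 ∨ R i j = -1) → R * R.transpose = 1 → ∀ (p q : (Fin 4 → ℝ)) μ ν la, Γ m (R.mulVec p) (R.mulVec q) μ ν la = ((R.det : ℝ) : ℂ) * ∑ μ', ∑ ν', ∑ la', ((R μ μ' * R ν ν' * R la la' : ℝ) : ℂ) * Γ m p q μ' ν' la') ∧ (∀ ν la, (fun k : V8 => ∑ μ : Fin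 4, ((k.1 μ : ℝ) : ℂ) * Γ m k.1 k.2 μ ν la) =o[𝓝 0] q2) ∧ (∀ μ la, (fun k : V8 => ∑ ν : Fin 4, ((k.2 ν : ℝ) : ℂ) * Γ m k.1 k.2 μ ν la) =o[𝓝 0] q2) ∧ (∀ μ ν la, DifferentiableAt ℝ (fun k : V8 => Γ m k.1 k.2 μ ν la) 0) ∧ (∀ μ ν, (fun k : V8 => (∑ la : Fin 4, ((k.1 la + k.2 la : ℝ) : ℂ) * Γ m k.1 k.2 μ ν la) - ((κ * m : ℝ) : ℂ) * ΓP m k.1 k.2 μ ν - c * ((Matrix.det (Matrix.of ![Pi.single μ 1, Pi.single ν 1, k.1, k.2]) : ℝ) : ℂ)) =o[𝓝 0] q2))) ∧ (∀ Rl : ℝ, 0 < Rl → ∃ C : ℝ, ∀ m : ℝ, 0 < m → m ≤ 1 → ∀ (i j : ℕ), 1 ≤ i → i ≤ 2 → 1 ≤ j → j ≤ 2 → ∀ μ ν : Fin 4, Ev fun k S => (∑ x ∈ box 4 S, ∑ y ∈ box 4 S, if ‖ph k x‖ ≤ Rl ∧ ‖ph k y‖ ≤ Rl then reg'.a k ^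 8 * ‖ph k x‖ ^ i * ‖ph k y‖ ^ j * ‖((uV k * uV k * uP k : ℝ) : ℂ) * C3 k S m (V μ) (V ν) P x y‖ else 0) ≤ C) ∧ (∃ σ : ℝ, σ < 4 ∧ ∀ τ : ℝ, 0 < τ → ∃ C : ℝ, ∀ m : ℝ, 0 < m → m ≤ 1 → ∀ ι₁ ι₂ : Option (Fin 4 ⊕ Unit), Ev fun k S => ∀ x ∈ box 4 S, ∀ y ∈ box 4 S, τ ≤ ph k x 0 → τ ≤ ph k y 0 → ‖ph k x‖ ≤ τ⁻¹ → ‖ph k y‖ ≤ τ⁻¹ → ‖(((w ι₁ k * w ι₂ k) ^ 2 : ℝ) : ℂ) * (E k S m (fun U => R2 S (O ι₁) (O ι₂) x y U * P2 S (O ι₁) (O ι₂) x y U) - E k S m (R2 S (O ι₁) (O ι₂) x y) * E k S m (P2 S (O ι₁) (O ι₂) x y))‖ ≤ C * (reg'.a k + ‖ph k x - ph k y‖) ^ (-(2 * σ))) ∧ (∀ m : ℝ, 0 < m → m ≤ 1 → ∀ μ : Fin 4, Ev fun k S => ∀ x ∈ box 4 S, E k S m ((V μ).onTorus (2 * S +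 1) x) = 0) ∧ (∀ m : ℝ, 0 < m → m ≤ 1 → Ev fun k S => ∀ x ∈ box 4 S, E k S m (P.onTorus (2 * S + 1) x) = 0)

/-- **Statement of the shared stub — `AnomalyRigidity.UniformGapFarMoments` (item stmt-QuantumFields-17718) BY NAME.**
[folklore] -/
def stub_uniformGapFarMoments : Prop :=
  UniformGapFarMoments

end Stmt

/-! ## §2 The registered stubs (the ONLY `sorry`s of this file) -/

/-- **(W) corner-pinned + uniformly gapped ⇒ subsequential centred anomalous Ward data with PCAC coefficient `κ·m`**
(`= Stmt.stub_cornerWardData` by `rfl`; hardest, open: anomaly inflow for Wilson quarks under a gap + "the intrinsic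
corner is PCAC-chiral" + tree-level power counting along AF sequences). -/
theorem stub_cornerWardData :
    ∀ Nf : ℕ, Nf = 2 ∨ Nf = 3 → ∀ (reg : QCDRegularisation Nf) (mc : ℕ → ℝ),
        (∀ᶠ k in atTop, IsLUB {μ : ℝ | ¬ (∀ (R R' : ℕ) (A : QCDLatticeObservable Nf R)
            (B : QCDLatticeObservable Nf R'), ∃ (C δ : ℝ) (S₀ : ℕ), 0 < δ ∧ ∀ S : ℕ, S₀ ≤ S → ∀ n : ℕ, n ≤ S →
              ‖qcdLatticeConnectedCorr (reg.β k) (2 * S + 1) (fun _ : Fin Nf => μ) A B n‖ ≤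
                C * Real.exp (-(δ * n)))} (mc k)) →
        Tendsto (fun k => (reg.mcrit k - mc k) * reg.Zm k / reg.a k) atTop (nhds 0) →
        reg.HasMassScaling → (reg.scheme 0 0 0).HasAsymptoticScaling →
        (∀ᶠ k in atTop, (-1 : ℝ) < reg.mcrit k) →
        ∀ ε : ℝ, 0 < ε → (∀ m : Fin Nf → ℝ, (∀ f, 0 < m f) → (reg.scheme m 0 0).HasLatticeMassGap ε) →
        ∃ (φ : ℕ → ℕ) (hφ : StrictMono φ), ∃ (V A : Fin 4 → QCDLatticeObservable Nf 1) (P : QCDLatticeObservable Nf 1) (uV uA uP : ℕ → ℝ) (Γ : ℝ → (Fin 4 → ℝ) → (Fin 4 → ℝ) → Fin 4 → Fin 4 → Fin 4 → ℂ) (ΓP : ℝ → (Fin 4 → ℝ) → (Fin 4 → ℝ) → Fin 4 → Fin 4 → ℂ) (c : ℂ) (κ : ℝ), let reg' : QCDRegularisation Nf := reg.restrict φ hφ.tendsto_atTop; let ph := fun (k : ℕ) (x : Fin 4 → ℤ) (i : Fin 4) => reg'.a k * (x i : ℝ); let E := fun (k S : ℕ) (m : ℝ) X => qcdTorusExpect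 (reg'.β k) (2 * S + 1) (fun fl => (reg'.scheme (fun _ => m) 0 0).mq fl k) X; let C3 := fun (k S : ℕ) (m : ℝ) (X Y Z : QCDLatticeObservable Nf 1) x y => E k S m (fun U => X.onTorus (2 * S + 1) x U * Y.onTorus (2 * S + 1) y U * Z.onTorus (2 * S + 1) 0 U); let F3 := fun (k S : ℕ) (m : ℝ) X Y Z (a b d : ℕ → ℝ) (p q : Fin 4 → ℝ) => ((reg'.a k ^ 8 : ℝ) : ℂ) * ∑ x ∈ box 4 S, ∑ y ∈ box 4 S, Complex.exp (Complex.I * ((∑ i : Fin 4, (p i * ph k x i + q i * ph k y i) : ℝ) : ℂ)) * ((a k * b k * d k : ℝ) : ℂ) * C3 k S m X Y Z x y; let O := fun o : Option (Fin 4 ⊕ Unit) => Option.elim o (QCDLatticeObservable.one Nf 1) (Sum.elim V fun _ => P); let w := fun o : Option (Fin 4 ⊕ Unit) => Option.elim o (fun _ => (1 : ℝ)) (Sum.elim (fun _ => uV) fun _ => uP); let R2 := fun (S : ℕ) (X Y : QCDLatticeObservable Nf 1) x y U => Y.osAdjoint.onTorus (2 * S + 1) (siteReflect y) U * X.osAdjoint.onTorus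 (2 * S + 1) (siteReflect x) U; let P2 := fun (S : ℕ) (X Y : QCDLatticeObservable Nf 1) x y U => X.onTorus (2 * S + 1) x U * Y.onTorus (2 * S + 1) y U; let V8 := (Fin 4 → ℝ) × (Fin 4 → ℝ); let q2 := fun k : V8 => ‖k‖ ^ 2; let Ev := fun (Q : ℕ → ℕ → Prop) => ∀ᶠ k in Filter.atTop, ∀ S, reg'.L k ≤ S → Q k S; c ≠ 0 ∧ 0 < κ ∧ (∀ m : ℝ, 0 < m → m ≤ 1 → ((∀ p q μ ν la, ∀ δ : ℝ, 0 < δ → Ev fun k S => ‖F3 k S m (V μ) (V ν) (A la) uV uV uA p q - Γ m p q μ ν la‖ ≤ δ) ∧ (∀ p q μ ν, ∀ δ : ℝ, 0 < δ → Ev fun k S => ‖F3 k S m (V μ) (V ν) P uV uV uP p q - ΓP m p q μ ν‖ ≤ δ) ∧ (∀ R : Matrix (Fin 4) (Fin 4) ℝ, (∀ i j, R i j = 0 ∨ R i j = 1 ∨ R i j = -1) → R * R.transpose = 1 → ∀ (p q : (Fin 4 → ℝ)) μ ν la, Γ m (R.mulVec p) (R.mulVec q) μ ν la = ((R.det : ℝ)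 : ℂ) * ∑ μ', ∑ ν', ∑ la', ((R μ μ' * R ν ν' * R la la' : ℝ) : ℂ) * Γ m p q μ' ν' la') ∧ (∀ ν la, (fun k : V8 => ∑ μ : Fin 4, ((k.1 μ : ℝ) : ℂ) * Γ m k.1 k.2 μ ν la) =o[𝓝 0] q2) ∧ (∀ μ la, (fun k : V8 => ∑ ν : Fin 4, ((k.2 ν : ℝ) : ℂ) * Γ m k.1 k.2 μ ν la) =o[𝓝 0] q2) ∧ (∀ μ ν la, DifferentiableAt ℝ (fun k : V8 => Γ m k.1 k.2 μ ν la) 0) ∧ (∀ μ ν, (fun k : V8 => (∑ la : Fin 4, ((k.1 la + k.2 la : ℝ) : ℂ) * Γ m k.1 k.2 μ ν la) - ((κ * m : ℝ) : ℂ) * ΓP m k.1 k.2 μ ν - c * ((Matrix.det (Matrix.of ![Pi.single μ 1, Pi.single ν 1, k.1, k.2]) : ℝ) : ℂ)) =o[𝓝 0] q2))) ∧ (∀ Rl : ℝ, 0 < Rl → ∃ C : ℝ, ∀ m : ℝ, 0 < m → m ≤ 1 → ∀ (i j : ℕ), 1 ≤ i → i ≤ 2 → 1 ≤ j → j ≤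 2 → ∀ μ ν : Fin 4, Ev fun k S => (∑ x ∈ box 4 S, ∑ y ∈ box 4 S, if ‖ph k x‖ ≤ Rl ∧ ‖ph k y‖ ≤ Rl then reg'.a k ^ 8 * ‖ph k x‖ ^ i * ‖ph k y‖ ^ j * ‖((uV k * uV k * uP k : ℝ) : ℂ) * C3 k S m (V μ) (V ν) P x y‖ else 0) ≤ C) ∧ (∃ σ : ℝ, σ < 4 ∧ ∀ τ : ℝ, 0 < τ → ∃ C : ℝ, ∀ m : ℝ, 0 < m → m ≤ 1 → ∀ ι₁ ι₂ : Option (Fin 4 ⊕ Unit), Ev fun k S => ∀ x ∈ box 4 S, ∀ y ∈ box 4 S, τ ≤ ph k x 0 → τ ≤ ph k y 0 → ‖ph k x‖ ≤ τ⁻¹ → ‖ph k y‖ ≤ τ⁻¹ → ‖(((w ι₁ k * w ι₂ k) ^ 2 : ℝ) : ℂ) * (E k S m (fun U => R2 S (O ι₁) (O ι₂) x y U * P2 S (O ι₁) (O ι₂) x y U) - E k S m (R2 S (O ι₁) (O ι₂) x y) * E k S m (P2 S (O ι₁) (O ι₂) x y))‖ ≤ C * (reg'.a k + ‖ph k x -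 ph k y‖) ^ (-(2 * σ))) ∧ (∀ m : ℝ, 0 < m → m ≤ 1 → ∀ μ : Fin 4, Ev fun k S => ∀ x ∈ box 4 S, E k S m ((V μ).onTorus (2 * S + 1) x) = 0) ∧ (∀ m : ℝ, 0 < m → m ≤ 1 → Ev fun k S => ∀ x ∈ box 4 S, E k S m (P.onTorus (2 * S + 1) x) = 0) := by
  sorry

/-- **(17718) uniform gap ⇒ far moments** — the open crux `AnomalyRigidity.UniformGapFarMoments`, shared BY NAME. -/
theorem stub_uniformGapFarMoments : UniformGapFarMoments := by
  sorry

/-! ## §3 Reindexing bookkeeping (sorry-free) -/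

variable {Nf : ℕ}

/-- The uniform lattice gap passes to every reindexing `reg.restrict φ hφ` (the data of the reindexed scheme at `k` are
those of the original at `φ k`, definitionally). [folklore] -/
theorem hasLatticeMassGap_restrict (reg : QCDRegularisation Nf) (φ : ℕ → ℕ) (hφ : Tendsto φ atTop atTop)
    (m : Fin Nf → ℝ) (z s : QCDField Nf → ℕ → ℝ) {Δ : ℝ} (h : (reg.scheme m z s).HasLatticeMassGap Δ) :
    ((reg.restrict φ hφ).scheme m z s).HasLatticeMassGap Δ := by
  intro R R' A B
  obtain ⟨C, hC⟩ := h R R' A B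
  exact ⟨C, (hφ.eventually hC).mono fun k hk S hS n hn => hk S hS n hn⟩

/-- Two-loop asymptotic scaling passes to every reindexing. [folklore] -/
theorem hasAsymptoticScaling_restrict (reg : QCDRegularisation Nf) (φ : ℕ → ℕ) (hφ : Tendsto φ atTop atTop)
    (h : (reg.scheme 0 0 0).HasAsymptoticScaling) : ((reg.restrict φ hφ).scheme 0 0 0).HasAsymptoticScaling := by
  obtain ⟨Λ, hΛ, ht⟩ := h
  exact ⟨Λ, hΛ, ht.comp hφ⟩

/-- The physical branch along every degenerate positive ray of a reindexed regularisation with `m_crit > −1` eventually.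
[folklore] -/
theorem branch_restrict (reg : QCDRegularisation Nf) (φ : ℕ → ℕ) (hφ : Tendsto φ atTop atTop)
    (hbr : ∀ᶠ k in atTop, (-1 : ℝ) < reg.mcrit k) (m : ℝ) (hm : 0 < m) (fl : Fin Nf) :
    ∀ᶠ k in atTop, (-1 : ℝ) < ((reg.restrict φ hφ).scheme (fun _ : Fin Nf => m) 0 0).mq fl k := by
  filter_upwards [hφ.eventually hbr] with k hk
  have hpos : 0 ≤ reg.a (φ k) * m / reg.Zm (φ k) :=
    div_nonneg (mul_nonneg (reg.a_pos _).le hm.le) (reg.Zm_pos _).le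
  show (-1 : ℝ) < reg.mcrit (φ k) + reg.a (φ k) * m / reg.Zm (φ k)
  linarith

/-- Negating the pin: a regularisation that is not chiral at zero has ONE rate at ALL positive tuples. [folklore] -/
theorem uniformGap_of_not_isChiralAtZero (reg : QCDRegularisation Nf) (h : ¬ reg.IsChiralAtZero) :
    ∃ ε : ℝ, 0 < ε ∧ ∀ m : Fin Nf → ℝ, (∀ f, 0 < m f) → (reg.scheme m 0 0).HasLatticeMassGap ε := by
  unfold QCDRegularisation.IsChiralAtZero at h
  push Not at h
  obtain ⟨ε, hε, hm⟩ := h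
  exact ⟨ε, hε, hm⟩

/-! ## §4 Composition (kernel-checked): the crux BY NAME from the two stub statements -/

/-- **THE CRUX FROM THE TWO STUBS** — concludes `Summit.QuantumFields.QCD.Theses.EulerDescent.ChiralCornerSoftness` BY NAME:
negate the pin, get Ward data along `φ` from W, feed 17718 on `reg.restrict φ`, then the two landed germ lemmas give
`c = 0`, contradicting `c ≠ 0`. [folklore] -/
theorem ChiralCornerSoftness_of :
    Stmt.stub_cornerWardData → Stmt.stub_uniformGapFarMoments → ChiralCornerSoftness := by
  intro hW h3 Nf hNf reg mc hcorner hpin hms haf hbr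
  by_contra hchi
  obtain ⟨ε, hε, hgap⟩ := uniformGap_of_not_isChiralAtZero reg hchi
  obtain ⟨φ, hφ, V, A, P, uV, uA, uP, Γ, ΓP, c, κ, hc, hκ, hper, hU1, hU2, hcV, hcP⟩ :=
    hW Nf hNf reg mc hcorner hpin hms haf hbr ε hε hgap
  set reg' : QCDRegularisation Nf := reg.restrict φ hφ.tendsto_atTop with hreg'
  have hgap' : ∀ m : ℝ, 0 < m → m ≤ 1 →
      (reg'.scheme (fun _ : Fin Nf => m) 0 0).HasLatticeMassGap ε :=
    fun m hm _ => hasLatticeMassGap_restrict reg φ hφ.tendsto_atTop _ 0 0 (hgap (fun _ => m) fun _ => hm)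
  have hbranch' : ∀ m : ℝ, 0 < m → m ≤ 1 → ∀ fl : Fin Nf, ∀ᶠ k in atTop,
      (-1 : ℝ) < (reg'.scheme (fun _ : Fin Nf => m) 0 0).mq fl k :=
    fun m hm _ fl => branch_restrict reg φ hφ.tendsto_atTop hbr m hm fl
  have hAS' : (reg'.scheme 0 0 0).HasAsymptoticScaling :=
    hasAsymptoticScaling_restrict reg φ hφ.tendsto_atTop haf
  have hfar := h3 Nf reg' V P uV uP ε 1 hU2 hε one_pos le_rfl hgap' hbranch' hNf hAS' hcV hcP
  obtain ⟨K, hK⟩ := stub_farMomentsBoundGerm Nf reg' V P uV uP ΓP 1 one_pos le_rfl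
    (fun m hm hm1 => (hper m hm hm1).2.1) hU1 hfar
  exact hc (stub_anomalyGermVanishes Γ ΓP c κ K 1 one_pos hκ.le fun m hm hm1 =>
    ⟨(hper m hm hm1).2.2.1, (hper m hm hm1).2.2.2.1, (hper m hm hm1).2.2.2.2.1,
      (hper m hm hm1).2.2.2.2.2.1, (hper m hm hm1).2.2.2.2.2.2, hK m hm hm1⟩)

/-- The crux along this skeleton, from the registered stubs (sorries only inside `stub_*`; also certifies that each
`Stmt.stub_<name>` is definitionally the signature of `stub_<name>`). -/
theorem chiralCornerSoftness_of_stubs : ChiralCornerSoftness :=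
  ChiralCornerSoftness_of stub_cornerWardData stub_uniformGapFarMoments

end Summit.QuantumFields.QCD.Cruxes.ChiralCornerSoftness.AnomalyCorner
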